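import Literature.AnabelianGeometry.EtaleTheta.SettingModelKummerCocycleNegOne
import Literature.AnabelianGeometry.EtaleTheta.SettingModelChiKummerData
import HarnessLib

/-!
# `κ_{−1} = (χ − 1)/2` in abc-iut-w5-d171's `half` currency (proof-only sequel of
# `SettingModelKummerCocycleNegOne`)

S. Mochizuki, *The étale theta function …*, Publ. RIMS **45** (2009) [EtTh], §1, Prop. 1.5 (iii) p. 23 ("`log(O^×_K̈)`",
the `Π^tp_Y/Π^tp_Ÿ`-move of `log(Ü)`) [cite: MochizukiEtTh2009, Prop 1.5 (iii) p.23]. abc-iut cell, layer L2, seat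
abc-iut-L2-t5 (gen 6), R78 stage 2, F7q sub-input (s3′) — the second of the two normal forms abc-iut-L2-t6 asked for
(11:13:18Z): with abc-iut-w5-d171's `sqHom` / `half` (`SettingModelChiKummerData`), the even element
`χ(σ)(ι1)·(ι1)⁻¹ ∈ 2Ẑ` (`chi_iotaZ_div_mem_range_sqHom`, evenness = `level_two_chi_iotaZ_div`) has HALF exactly
`κ_{−1}(σ)` (`kappaNegOne_eq_half`), by `kappaNegOne_sq` and injectivity of squaring on `Ẑ`. PROOF-ONLY (0 defs);
semi-synthetic model bookkeeping, classical Kummer theory; nothing of [EtTh] asserted; no bearing on [IUTchIII] Cor. 3.12.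
-/

noncomputable section

namespace Literature.AnabelianGeometry.EtaleTheta.SettingModel

open Literature.AnabelianGeometry.SemiGraphs (GQp)

variable (p : ℕ) [Fact p.Prime]

/-- `χ(σ)(ι1)·(ι1)⁻¹ ∈ 2Ẑ` («`χ − 1` is even»: `χ_2 ≡ 1`). [cite: MochizukiEtTh2009, Prop 1.5 (iii) p.23] -/
theorem chi_iotaZ_div_mem_range_sqHom (σ : GQp p) :
    chi p σ (iotaZ (Multiplicative.ofAdd 1)) * (iotaZ (Multiplicative.ofAdd 1))⁻¹ ∈ sqHom.range := by
  rw [mem_range_sqHom_iff, modN_eq_level]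
  exact level_two_chi_iotaZ_div p σ

/-- **`κ_{−1}(σ) = half (χ(σ)(ι1)·(ι1)⁻¹)`** — abc-iut-w5-d171's `half` of the even element `χ(σ)·1 − 1` of `Ẑ`
(written multiplicatively). [cite: MochizukiEtTh2009, Prop 1.5 (iii) p.23] -/
theorem kappaNegOne_eq_half (σ : GQp p) :
    kappaNegOne p σ =
      half ⟨chi p σ (iotaZ (Multiplicative.ofAdd 1)) * (iotaZ (Multiplicative.ofAdd 1))⁻¹,
        chi_iotaZ_div_mem_range_sqHom p σ⟩ := by
  apply sqHom_injective
  rw [sqHom_apply, sqHom_apply, half_sq, kappaNegOne_sq]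

/-- The same for any chosen membership witness. [cite: MochizukiEtTh2009, Prop 1.5 (iii) p.23] -/
theorem kappaNegOne_eq_half' (σ : GQp p)
    (h : chi p σ (iotaZ (Multiplicative.ofAdd 1)) * (iotaZ (Multiplicative.ofAdd 1))⁻¹ ∈ sqHom.range) :
    kappaNegOne p σ = half ⟨_, h⟩ :=
  kappaNegOne_eq_half p σ

end Literature.AnabelianGeometry.EtaleTheta.SettingModel

end
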